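import Literature.MathematicalPhysics.QuantumFieldTheory.Balaban1983to89.B12Lineariz267
import Literature.MathematicalPhysics.QuantumFieldTheory.Balaban1983to89.B13PkScaling
import Literature.MathematicalPhysics.QuantumFieldTheory.Balaban1983to89.B13Sect1Arith
import Literature.MathematicalPhysics.QuantumFieldTheory.Balaban1983to89.B12LinearizAnalytic267

/-!
# `Balaban1983to89.B13Eq119BPrime` — T. Bałaban, *Renormalization group approach to lattice gauge field theories.
II. Cluster expansions*, Commun. Math. Phys. **116** (1988) 1–22 [Balaban1988RG2Cluster], (1.19)–(1.20) p. 6: the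
function `B′ = g_kCB − hD̃(g_kCB)` and its bound `|B′| ≦ O(1)g_k|B| + 4C₂(O(1)g_k|B|)² ≦ C₁g_k|B| < C₁ε₁` — typed on the
abstract complex-normed-space model of `B13Ineq140`/`B13PkScaling`/`B12Lineariz267`, the bound PROVED with explicit `C₁`

statement-level skeleton of published theorems with citation tags; proofs where landed; nothing here is a claim about the Yang–Mills mass gap

PDF held: `paper:balaban1988-cmp116-rg-ii-cluster` (journal page = PDF page).  Displays read on the ×2 page renders
`run/shared/lean/pub/pub-balaban/b2b-balaban-ref1/pages/1988-cmp116-rg-II-cluster/1988-cmp116-rg-II-cluster-p005-x2.png`,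
`…-p006-x2.png` (pp. 5–6), as images (the publisher's text layer is garbled).

CITATION HEADER / WHAT IS REPRODUCED.  p. 6 [PDF 6], verbatim: *"We have to consider the function B′ yet. Notice that in
the preceding considerations B′ was a variable field. The function is given by the formula B′ = g_kCB − hD̃(g_kCB). (1.19)
It satisfies the bound |B′| ≦ O(1)g_k|B| + 4C₂(O(1)g_k|B|)² ≦ C₁g_k|B| < C₁ε₁, (1.20) where C₁ is an absolute constant,
and g_k|B| < ε₁."*  Context: [Balaban1987RG1] (= [I]) p. 270 *«B′ = g_kCB − hD̃(g_kCB). (3.2)»*, p. 268 *«Denoting the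
remaining variables by B we have B′ = CB, C is the operator determined by the configuration V^{(k)}»*, p. 267 (the operator
`h` and the function `D̃` of the linearizing substitution `B′ = B − hD̃(B)`, typed hypothesis-style in
`…Balaban1983to89.B12Lineariz267`, where *«D̃(B) has an expansion beginning with quadratic terms»* is the kernel theorem
`norm_Dt_le`/`norm_hop_Dt_le`: `‖hD̃(B)‖ ≤ 4C₂b‖B‖²` on `‖B‖ < ε`); [Balaban1988RG2Cluster] (1.14) p. 5 *«|D(H(s(Y₀)), A′)|
≦ 4C₂|A′|²»* (the same contraction bound, `B13Contraction113.bound_114`); p. 10 l. −1 – p. 11 l. 1 *«Taking B′ as in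
(1.19) we obtain the above bound with |B′| replaced by C₁ε₁»* — the consumer, `…Balaban1983to89.B13PkScaling` §4, which takes
the field map `Ψ₁ : B ↦ B′` (at `g_k = 1`) ABSTRACTLY with the two hypotheses `AnalyticOnNhd ℂ Ψ₁ (ball 0 R₀)` and
(1.20) `∀ w ∈ ball 0 R₀, ‖Ψ₁ w‖ ≤ C₁‖w‖` (`norm_Qop_T7_le`, `scaled_T7_eq_Qop`).
THIS FILE (SKELETON row B13.Eq1.19, listed `absent (schematic)` at v3.11; lit-balaban SPARE list): (1.19) AS A DEFINITION
on that model — `bPrime g C hop Dt B = g•CB − hop (Dt (g•CB))` over abstract complex normed spaces (`B ∈ 𝒲` the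
«remaining variables», `C : 𝒲 →L[ℂ] 𝒴` bounded linear, `hop : 𝒳 →ₗ[ℂ] 𝒴` = print's `h`, `Dt : 𝒴 → 𝒳` = print's `D̃`),
`psi1` = the same map at `g_k = 1` (`bPrime g = psi1 ∘ (g • ·)`, `bPrime_eq_psi1`; it IS `B12Lineariz267`'s substitution
`X ↦ X − hD̃(X)` at `X = g_kCB`, `bPrime_eq_phi`); (1.20) PROVED (`ineq120`: the three printed inequalities, with
`O(1) = c₀` = the displayed bound `‖Cw‖ ≤ c₀‖w‖` and the displayed (1.14)-type bound `‖hD̃(X)‖ ≤ 4C₂‖X‖²` on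
`‖X‖ < R_D`, on the domain `g_k|B| < ε₁` with `c₀ε₁ ≤ R_D`, and the EXPLICIT `C₁ = c₀(1 + 4C₂c₀ε₁)` — the first inequality
is the object-level step for the typed `B′`, the second and third ARE the real arithmetic already kernel-checked in
`…Balaban1983to89.B13Sect1Arith` (`bound_120`, `lt_120`, with the same `C₁`; its `C₁_le_120`: `C₁ ≤ 2c₀` under the census
restriction R5 `4C₂c₀ε₁ ≤ 1` = *«C₁ is an absolute constant»*), used BY NAME, not re-derived (SKELETON row B13.Eq1.20 is
`proved-existing` by that file; this file supplies the OBJECT of row B13.Eq1.19 and the instance); the two `B13PkScaling`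
hypotheses DISCHARGED for the concrete `Ψ₁`
(`norm_psi1_le` = (1.20) at `g_k = 1` on any ball `c₀R₀ ≤ R_D`; `analyticOnNhd_psi1` from `D̃` analytic — print p. 267
*«it is an analytic function of B»*, a displayed hypothesis here since `B12Lineariz267` types analyticity of `D̃` along
complex lines only), whence `norm_Qop_T7_bPrime_le` = `B13PkScaling.norm_Qop_T7_le` for THE PRINTED `B′`; and §4 the same
(1.20) with `4C₂ ↦ 4C₂b` DERIVED from `B12Lineariz267`'s hypotheses (`QuadAnalytic C̃ C₂ R`, `‖hX‖ ≤ b‖X‖`, `9C₂bε < 1`,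
`3ε ≤ R`, `D̃` the fixed point: `norm_hop_Dt_le`), `ineq120_of_lineariz` (print's `4C₂` is the case `b ≤ 1`,
`ineq120_printed_of_b_le_one`).
MODEL / DIVERGENCE (as in `B13PkScaling`, cell row D-b13.21): complex `g` (the real coupling `g_k > 0` is `‖g‖ = g_k`) and
open balls; `|·|` = the norm of the abstract space (print: the sup-type norms of [13]); nothing of the series beyond the
displayed hypotheses is asserted; NOT summit progress.  Unit `lit-balaban-p32` (Phase-2 proof seat p32, SPARE row
B13.Eq1.19), HOME `run/shared/lean/pub/lit-balaban/`.

v1.1 (same seat, append-only): §5 — the analyticity hypothesis `hDt` of §3 DISCHARGED from [I] p. 267's typed data by the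
tree's `…Balaban1983to89.B12LinearizAnalytic267.analyticOnNhd_Dt` (the sibling of `B12Lineariz267` that supplies the JOINT
(Fréchet) analyticity of `D̃`; v1's phrase «`B12Lineariz267` types analyticity of `D̃` along complex lines only» is true of
that module but the sibling closes it), whence `analyticOnNhd_psi1_of_lineariz` and `norm_Qop_T7_bPrime_le_of_lineariz`
(Lemma 2 / T7 for THE PRINTED `B′` with every hypothesis = [I] p. 267's data + the bound on `C`); and `constraint_bPrime`:
in the new variables the constraint function of `δ(Q̃(B′))` vanishes identically, `LQ̃B′ + C̃(B′) = 0`, when `C`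
parametrizes `ker LQ̃` ([I] p. 268 *«Denoting the remaining variables by B we have B′ = CB»*) — an observation of the yielded
parallel draft `HOME/lit-balaban-p07/B13Eq119ChangeOfVariables.lean` (seat p07, `constraint_Bprime`), re-proved here in two
lines from `B12Lineariz267.linearizes_Dt` with credit.  No v1 declaration changed.
-/

/- Nested operator spaces `E →L[ℂ] E →L[ℂ] F` (the operator `Qop` of `B13PkScaling`) need one more level of pending
instance synthesis than the default, as in `B13PkScaling`. -/
set_option maxSynthPendingDepth 3

noncomputable section

namespace Literature.MathematicalPhysics.QuantumFieldTheory.Balaban1983to89.B13Eq119BPrime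

open Metric Set
open B13Ineq140 (rad rad_pos Ineq139)
open B13PkScaling (Qop scaled norm_Qop_T7_le)
open B13Contraction113 (QuadAnalytic)

variable {𝒲 𝒴 𝒳 : Type*} [NormedAddCommGroup 𝒲] [NormedSpace ℂ 𝒲] [NormedAddCommGroup 𝒴] [NormedSpace ℂ 𝒴]
  [NormedAddCommGroup 𝒳] [NormedSpace ℂ 𝒳]

/-! ## §1. (1.19) typed -/

/-- **(1.19) p. 6 at `g_k = 1`** — the field map `Ψ₁ : w ↦ Cw − hD̃(Cw)` (so that `B′ = Ψ₁(g_kB)`; this is the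
abstract `Ψ₁` of `B13PkScaling.norm_Qop_T7_le`): `C : 𝒲 →L[ℂ] 𝒴` the operator of [I] p. 268 *«B′ = CB, C is the operator
determined by the configuration V^{(k)}»*, `hop` = the operator `h` and `Dt` = the function `D̃` of [I] p. 267.
[cite: Balaban1988RG2Cluster, (1.19) p.6] -/
def psi1 (C : 𝒲 →L[ℂ] 𝒴) (hop : 𝒳 →ₗ[ℂ] 𝒴) (Dt : 𝒴 → 𝒳) (w : 𝒲) : 𝒴 := C w - hop (Dt (C w))

/-- **(1.19) p. 6 [PDF 6]**, verbatim: *"The function is given by the formula B′ = g_kCB − hD̃(g_kCB). (1.19)"* — typed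
reading: `B′ = g•CB − h(D̃(g•CB))` for a (complex) coupling `g`, the «remaining variables» `B ∈ 𝒲`, `C : 𝒲 →L[ℂ] 𝒴`,
`h : 𝒳 →ₗ[ℂ] 𝒴`, `D̃ : 𝒴 → 𝒳` (= [I] (3.2) p. 270). [cite: Balaban1988RG2Cluster, (1.19) p.6] -/
def bPrime (g : ℂ) (C : 𝒲 →L[ℂ] 𝒴) (hop : 𝒳 →ₗ[ℂ] 𝒴) (Dt : 𝒴 → 𝒳) (B : 𝒲) : 𝒴 :=
  g • C B - hop (Dt (g • C B))

/-- Unfolding (1.19). [cite: Balaban1988RG2Cluster, (1.19) p.6] -/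
theorem bPrime_def (g : ℂ) (C : 𝒲 →L[ℂ] 𝒴) (hop : 𝒳 →ₗ[ℂ] 𝒴) (Dt : 𝒴 → 𝒳) (B : 𝒲) :
    bPrime g C hop Dt B = g • C B - hop (Dt (g • C B)) := rfl

/-- Unfolding `Ψ₁`. [cite: Balaban1988RG2Cluster, (1.19) p.6] -/
theorem psi1_def (C : 𝒲 →L[ℂ] 𝒴) (hop : 𝒳 →ₗ[ℂ] 𝒴) (Dt : 𝒴 → 𝒳) (w : 𝒲) :
    psi1 C hop Dt w = C w - hop (Dt (C w)) := rfl

/-- `B′ = Ψ₁(g_kB)` (linearity of `C`): the scaling bookkeeping of `B13PkScaling` §4 (*«(1.19) p. 6, is Ψ₁(g_kB)»*).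
[cite: Balaban1988RG2Cluster, (1.19) p.6] -/
theorem bPrime_eq_psi1 (g : ℂ) (C : 𝒲 →L[ℂ] 𝒴) (hop : 𝒳 →ₗ[ℂ] 𝒴) (Dt : 𝒴 → 𝒳) (B : 𝒲) :
    bPrime g C hop Dt B = psi1 C hop Dt (g • B) := by
  simp only [bPrime, psi1, map_smul]

/-- At `g_k = 1`, `B′ = Ψ₁(B)`. [cite: Balaban1988RG2Cluster, (1.19) p.6] -/
theorem bPrime_one (C : 𝒲 →L[ℂ] 𝒴) (hop : 𝒳 →ₗ[ℂ] 𝒴) (Dt : 𝒴 → 𝒳) (B : 𝒲) :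
    bPrime 1 C hop Dt B = psi1 C hop Dt B := by
  rw [bPrime_eq_psi1, one_smul]

/-- (1.19) IS [I] p. 267's linearizing substitution `X ↦ X − hD̃(X)` (the map of `B12Lineariz267`, written there
inline) evaluated at `X = g_kCB`. [cite: Balaban1988RG2Cluster, (1.19) p.6] -/
theorem bPrime_eq_phi (g : ℂ) (C : 𝒲 →L[ℂ] 𝒴) (hop : 𝒳 →ₗ[ℂ] 𝒴) (Dt : 𝒴 → 𝒳) (B : 𝒲) :
    bPrime g C hop Dt B = (fun X : 𝒴 => X - hop (Dt X)) (g • C B) := rfl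

/-! ## §2. (1.20) for the typed `B′`: the object-level instance of the arithmetic certified in `B13Sect1Arith` -/

/-- The constant of (1.20): `C₁ = c₀(1 + 4C₂c₀ε₁)` — `c₀` = the `O(1)` bounding `C`, `4C₂` = the quadratic constant of
`hD̃` ((1.14)); this is LITERALLY the explicit `C₁` of `B13Sect1Arith.bound_120` (whose `C₁_le_120` gives `C₁ ≤ 2c₀`
under the census restriction R5 `4C₂c₀ε₁ ≤ 1`: *«C₁ is an absolute constant»*). [cite: Balaban1988RG2Cluster, (1.20) p.6] -/
def C1 (c₀ C₂ ε₁ : ℝ) : ℝ := c₀ * (1 + 4 * C₂ * c₀ * ε₁)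

/-- Unfolding `C₁`. [cite: Balaban1988RG2Cluster, (1.20) p.6] -/
theorem C1_eq (c₀ C₂ ε₁ : ℝ) : C1 c₀ C₂ ε₁ = c₀ * (1 + 4 * C₂ * c₀ * ε₁) := rfl

/-- `C₁ ≥ c₀` (so `C₁ > 0` when `c₀ > 0`) for `C₂, c₀, ε₁ ≥ 0`. [cite: Balaban1988RG2Cluster, (1.20) p.6] -/
theorem c₀_le_C1 {c₀ C₂ ε₁ : ℝ} (hc₀ : 0 ≤ c₀) (hC₂ : 0 ≤ C₂) (hε₁ : 0 ≤ ε₁) : c₀ ≤ C1 c₀ C₂ ε₁ := by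
  unfold C1
  have h : 0 ≤ 4 * C₂ * c₀ * ε₁ := by positivity
  nlinarith

/-- `C₁ ≥ 0` for non-negative data. [cite: Balaban1988RG2Cluster, (1.20) p.6] -/
theorem C1_nonneg {c₀ C₂ ε₁ : ℝ} (hc₀ : 0 ≤ c₀) (hC₂ : 0 ≤ C₂) (hε₁ : 0 ≤ ε₁) : 0 ≤ C1 c₀ C₂ ε₁ :=
  hc₀.trans (c₀_le_C1 hc₀ hC₂ hε₁)

variable {C : 𝒲 →L[ℂ] 𝒴} {hop : 𝒳 →ₗ[ℂ] 𝒴} {Dt : 𝒴 → 𝒳} {c₀ C₂ R_D : ℝ}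

/-- The substitution is the identity up to a quadratic correction: `‖X − hD̃(X)‖ ≤ ‖X‖ + 4C₂‖X‖²` on the ball where the
(1.14)-type bound holds. [cite: Balaban1988RG2Cluster, (1.20) p.6] -/
theorem norm_phi_le (hhD : ∀ X : 𝒴, ‖X‖ < R_D → ‖hop (Dt X)‖ ≤ 4 * C₂ * ‖X‖ ^ 2) {X : 𝒴} (hX : ‖X‖ < R_D) :
    ‖X - hop (Dt X)‖ ≤ ‖X‖ + 4 * C₂ * ‖X‖ ^ 2 :=
  (norm_sub_le _ _).trans (by gcongr; exact hhD X hX)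

/-- The argument `g_kCB` of `D̃` has norm `≤ c₀·g_k|B|` and lies in the ball `‖·‖ < R_D`, when `g_k|B| < ε₁` and
`c₀ε₁ ≤ R_D`. [cite: Balaban1988RG2Cluster, (1.20) p.6] -/
theorem norm_smul_C_le (hC : ∀ w, ‖C w‖ ≤ c₀ * ‖w‖) (hc₀ : 0 < c₀) {ε₁ : ℝ} (hR : c₀ * ε₁ ≤ R_D) {g : ℂ} {B : 𝒲}
    (hB : ‖g‖ * ‖B‖ < ε₁) : ‖g • C B‖ ≤ c₀ * (‖g‖ * ‖B‖) ∧ ‖g • C B‖ < R_D := by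
  have h1 : ‖g • C B‖ ≤ c₀ * (‖g‖ * ‖B‖) := by
    rw [norm_smul]
    calc ‖g‖ * ‖C B‖ ≤ ‖g‖ * (c₀ * ‖B‖) := by gcongr; exact hC B
      _ = c₀ * (‖g‖ * ‖B‖) := by ring
  refine ⟨h1, h1.trans_lt ?_⟩
  calc c₀ * (‖g‖ * ‖B‖) < c₀ * ε₁ := by gcongr
    _ ≤ R_D := hR

/-- **(1.20), first inequality, for the typed `B′`**: `|B′| ≦ O(1)g_k|B| + 4C₂(O(1)g_k|B|)²` — `‖B′‖ ≤ c₀(g_k‖B‖) +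
4C₂(c₀ g_k‖B‖)²` with `O(1) = c₀` (`‖Cw‖ ≤ c₀‖w‖`) and the (1.14)-type bound `‖hD̃(X)‖ ≤ 4C₂‖X‖²` on `‖X‖ < R_D`, for
`g_k|B| < ε₁`, `c₀ε₁ ≤ R_D` (`g_k = ‖g‖`). [cite: Balaban1988RG2Cluster, (1.20) p.6] -/
theorem norm_bPrime_le_quad (hC : ∀ w, ‖C w‖ ≤ c₀ * ‖w‖) (hc₀ : 0 < c₀) (hC₂ : 0 ≤ C₂)
    (hhD : ∀ X : 𝒴, ‖X‖ < R_D → ‖hop (Dt X)‖ ≤ 4 * C₂ * ‖X‖ ^ 2) {ε₁ : ℝ} (hR : c₀ * ε₁ ≤ R_D) {g : ℂ} {B : 𝒲}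
    (hB : ‖g‖ * ‖B‖ < ε₁) :
    ‖bPrime g C hop Dt B‖ ≤ c₀ * (‖g‖ * ‖B‖) + 4 * C₂ * (c₀ * (‖g‖ * ‖B‖)) ^ 2 := by
  obtain ⟨h1, h2⟩ := norm_smul_C_le hC hc₀ hR hB
  calc ‖bPrime g C hop Dt B‖ ≤ ‖g • C B‖ + 4 * C₂ * ‖g • C B‖ ^ 2 := norm_phi_le hhD h2
    _ ≤ c₀ * (‖g‖ * ‖B‖) + 4 * C₂ * (c₀ * (‖g‖ * ‖B‖)) ^ 2 := by gcongr

/-- **(1.20) p. 6 [PDF 6] for the typed `B′`**, verbatim: *"It satisfies the bound |B′| ≦ O(1)g_k|B| + 4C₂(O(1)g_k|B|)² ≦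
C₁g_k|B| < C₁ε₁, (1.20) where C₁ is an absolute constant, and g_k|B| < ε₁."* — the three inequalities for
`B′ = bPrime g C hop Dt B` on `‖g‖‖B‖ < ε₁`, from the DISPLAYED hypotheses `‖Cw‖ ≤ c₀‖w‖` (the `O(1)`, `c₀ > 0`),
`‖hD̃(X)‖ ≤ 4C₂‖X‖²` for `‖X‖ < R_D` ((1.14)-type) and `c₀ε₁ ≤ R_D`; `C₁ = C1 c₀ C₂ ε₁ = c₀(1 + 4C₂c₀ε₁)`.  The first
inequality is the object-level step (`norm_bPrime_le_quad`); the second and third ARE the real arithmetic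
`B13Sect1Arith.bound_120` / `lt_120` (not re-derived). [cite: Balaban1988RG2Cluster, (1.20) p.6] -/
theorem ineq120 (hC : ∀ w, ‖C w‖ ≤ c₀ * ‖w‖) (hc₀ : 0 < c₀) (hC₂ : 0 ≤ C₂)
    (hhD : ∀ X : 𝒴, ‖X‖ < R_D → ‖hop (Dt X)‖ ≤ 4 * C₂ * ‖X‖ ^ 2) {ε₁ : ℝ} (hR : c₀ * ε₁ ≤ R_D) {g : ℂ} {B : 𝒲}
    (hB : ‖g‖ * ‖B‖ < ε₁) :
    ‖bPrime g C hop Dt B‖ ≤ c₀ * (‖g‖ * ‖B‖) + 4 * C₂ * (c₀ * (‖g‖ * ‖B‖)) ^ 2 ∧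
      c₀ * (‖g‖ * ‖B‖) + 4 * C₂ * (c₀ * (‖g‖ * ‖B‖)) ^ 2 ≤ C1 c₀ C₂ ε₁ * (‖g‖ * ‖B‖) ∧
        C1 c₀ C₂ ε₁ * (‖g‖ * ‖B‖) < C1 c₀ C₂ ε₁ * ε₁ := by
  have ha0 : 0 ≤ ‖g‖ * ‖B‖ := by positivity
  have hε₁ : 0 ≤ ε₁ := le_of_lt (lt_of_le_of_lt ha0 hB)
  have hC1 : 0 < C1 c₀ C₂ ε₁ := hc₀.trans_le (c₀_le_C1 hc₀.le hC₂ hε₁)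
  exact ⟨norm_bPrime_le_quad hC hc₀ hC₂ hhD hR hB, B13Sect1Arith.bound_120 hc₀.le hC₂ ha0 hB,
    B13Sect1Arith.lt_120 hC1 hB⟩

/-- (1.20) assembled: `‖B′‖ ≤ C₁·g_k|B|` and `‖B′‖ < C₁ε₁`. [cite: Balaban1988RG2Cluster, (1.20) p.6] -/
theorem norm_bPrime_le (hC : ∀ w, ‖C w‖ ≤ c₀ * ‖w‖) (hc₀ : 0 < c₀) (hC₂ : 0 ≤ C₂)
    (hhD : ∀ X : 𝒴, ‖X‖ < R_D → ‖hop (Dt X)‖ ≤ 4 * C₂ * ‖X‖ ^ 2) {ε₁ : ℝ} (hR : c₀ * ε₁ ≤ R_D) {g : ℂ} {B : 𝒲}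
    (hB : ‖g‖ * ‖B‖ < ε₁) :
    ‖bPrime g C hop Dt B‖ ≤ C1 c₀ C₂ ε₁ * (‖g‖ * ‖B‖) ∧ ‖bPrime g C hop Dt B‖ < C1 c₀ C₂ ε₁ * ε₁ := by
  obtain ⟨h1, h2, h3⟩ := ineq120 hC hc₀ hC₂ hhD hR hB
  exact ⟨h1.trans h2, (h1.trans h2).trans_lt h3⟩

/-! ## §3. The two hypotheses of `B13PkScaling` §4 discharged for the printed `Ψ₁`, and T7 for the printed `B′` -/

/-- **(1.20) at `g_k = 1` on a ball**: `‖Ψ₁ w‖ ≤ C₁(R₀)‖w‖` for `‖w‖ < R₀`, `c₀R₀ ≤ R_D`, `C₁(R₀) = c₀(1 + 4C₂c₀R₀)` —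
the hypothesis `h120` of `B13PkScaling.norm_Qop_T7_le` / `scaled_T7_eq_Qop` / `cubic_comp_of_linear_bound` for the
CONCRETE field map of (1.19). [cite: Balaban1988RG2Cluster, (1.20) p.6] -/
theorem norm_psi1_le (hC : ∀ w, ‖C w‖ ≤ c₀ * ‖w‖) (hc₀ : 0 < c₀) (hC₂ : 0 ≤ C₂)
    (hhD : ∀ X : 𝒴, ‖X‖ < R_D → ‖hop (Dt X)‖ ≤ 4 * C₂ * ‖X‖ ^ 2) {R₀ : ℝ} (hR : c₀ * R₀ ≤ R_D) :
    ∀ w ∈ ball (0 : 𝒲) R₀, ‖psi1 C hop Dt w‖ ≤ C1 c₀ C₂ R₀ * ‖w‖ := by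
  intro w hw
  have hw' : ‖(1 : ℂ)‖ * ‖w‖ < R₀ := by rw [norm_one, one_mul]; exact mem_ball_zero_iff.mp hw
  have h := (norm_bPrime_le hC hc₀ hC₂ hhD hR hw').1
  rwa [bPrime_one, norm_one, one_mul] at h

/-- `C` maps the ball `‖w‖ < R₀` into the ball `‖X‖ < R_D` of `D̃`'s quadratic bound (`c₀R₀ ≤ R_D`).
[cite: Balaban1988RG2Cluster, (1.19) p.6] -/
theorem mapsTo_C (hC : ∀ w, ‖C w‖ ≤ c₀ * ‖w‖) (hc₀ : 0 < c₀) {R₀ : ℝ} (hR : c₀ * R₀ ≤ R_D) :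
    MapsTo (fun w : 𝒲 => C w) (ball (0 : 𝒲) R₀) (ball (0 : 𝒴) R_D) := by
  intro w hw
  rw [mem_ball_zero_iff] at hw ⊢
  calc ‖C w‖ ≤ c₀ * ‖w‖ := hC w
    _ < c₀ * R₀ := by gcongr
    _ ≤ R_D := hR

/-- **`Ψ₁` is analytic** on `‖w‖ < R₀` (`c₀R₀ ≤ R_D`) when `D̃` is analytic on `‖X‖ < R_D` ([I] p. 267: *«there exists
exactly one solution of this equation, and that it is an analytic function of B»* — displayed hypothesis `hDt`; the
tree's `B12Lineariz267` types analyticity of `D̃` along complex lines only) and `h` is bounded (`‖hX‖ ≤ b‖X‖`): the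
hypothesis `hΨa` of `B13PkScaling.norm_Qop_T7_le` for the concrete field map of (1.19).
[cite: Balaban1988RG2Cluster, (1.19) p.6] -/
theorem analyticOnNhd_psi1 (hDt : AnalyticOnNhd ℂ Dt (ball (0 : 𝒴) R_D)) {b : ℝ} (hHop : ∀ X, ‖hop X‖ ≤ b * ‖X‖)
    (hC : ∀ w, ‖C w‖ ≤ c₀ * ‖w‖) (hc₀ : 0 < c₀) {R₀ : ℝ} (hR : c₀ * R₀ ≤ R_D) :
    AnalyticOnNhd ℂ (psi1 C hop Dt) (ball (0 : 𝒲) R₀) := by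
  have hCa : AnalyticOnNhd ℂ (fun w : 𝒲 => C w) (ball (0 : 𝒲) R₀) := fun w _ => C.analyticAt w
  have hDC : AnalyticOnNhd ℂ (fun w : 𝒲 => Dt (C w)) (ball (0 : 𝒲) R₀) := hDt.comp hCa (mapsTo_C hC hc₀ hR)
  let H : 𝒳 →L[ℂ] 𝒴 := hop.mkContinuous b hHop
  intro w hw
  have h2 : AnalyticAt ℂ (fun w : 𝒲 => H (Dt (C w))) w := (H.analyticAt _).comp (hDC w hw)
  have h3 : AnalyticAt ℂ (fun w : 𝒲 => C w - H (Dt (C w))) w := (hCa w hw).sub h2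
  exact h3

/-- The scaled T7 term for the printed `B′`: `g⁻²·Fk(Ψ₁(gB)) = g⁻²·Fk(B′)` (`B13PkScaling.scaled`).
[cite: Balaban1988RG2Cluster, (1.19) p.6] -/
theorem scaled_comp_psi1 {G : Type*} [NormedAddCommGroup G] [NormedSpace ℂ G] (Fk : 𝒴 → G) (g : ℂ) (B : 𝒲) :
    scaled g (Fk ∘ psi1 C hop Dt) B = (g ^ 2)⁻¹ • Fk (bPrime g C hop Dt B) := by
  simp only [scaled, Function.comp, bPrime_eq_psi1]

/-- **p. 10 l. −1 – p. 11 l. 1, *«Taking B′ as in (1.19) we obtain the above bound with |B′| replaced by C₁ε₁»*, for THE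
PRINTED `B′`**: `B13PkScaling.norm_Qop_T7_le` (Lemma 2 for the term `(1/g_k²)V(H₁B′)`, (1.37)–(1.43)) with its abstract
field map `Ψ₁` INSTANTIATED by (1.19) and its two hypotheses `hΨa`, `h120` DISCHARGED (`analyticOnNhd_psi1`,
`norm_psi1_le`, `C₁ = C1 c₀ C₂ R₀`): on `g_k|B| ≤ ε₁` the operator of the quadratic form of `g_k⁻²Fk(B′)` has norm
`≤ ½·27·C₃e^{48κ₁}·M⁴e^{−(κ₁−1)|Y∖□|}·C₁³·ε₁`. [cite: Balaban1988RG2Cluster, (1.37)–(1.43) pp.10–11] -/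
theorem norm_Qop_T7_bPrime_le {G : Type*} [NormedAddCommGroup G] [NormedSpace ℂ G]
    {κ₁ a₁ C₃ M nYc ε₁ R₀ b : ℝ} (ha₁ : 0 < a₁) (hC₃ : 0 ≤ C₃) (hε₁ : 0 < ε₁)
    {Fk : 𝒴 → G} (hFa : AnalyticOnNhd ℂ Fk (ball 0 (rad κ₁ a₁))) (h139 : Ineq139 Fk κ₁ a₁ C₃ M nYc)
    (hDt : AnalyticOnNhd ℂ Dt (ball (0 : 𝒴) R_D)) (hHop : ∀ X, ‖hop X‖ ≤ b * ‖X‖)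
    (hC : ∀ w, ‖C w‖ ≤ c₀ * ‖w‖) (hc₀ : 0 < c₀) (hC₂ : 0 ≤ C₂)
    (hhD : ∀ X : 𝒴, ‖X‖ < R_D → ‖hop (Dt X)‖ ≤ 4 * C₂ * ‖X‖ ^ 2) (hR : c₀ * R₀ ≤ R_D)
    (h3 : 3 * ε₁ ≤ R₀) (hrad : C1 c₀ C₂ R₀ * R₀ ≤ rad κ₁ a₁) {g : ℂ} (hg : g ≠ 0) {B : 𝒲} (hB : ‖g‖ * ‖B‖ ≤ ε₁) :
    ‖Qop (scaled g (Fk ∘ psi1 C hop Dt)) B‖ ≤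
      1 / 2 * (27 * (C₃ * Real.exp (48 * κ₁) * (M ^ 4 * Real.exp (-(κ₁ - 1) * nYc)) * C1 c₀ C₂ R₀ ^ 3) * ε₁) := by
  have hR₀ : 0 ≤ R₀ := by linarith
  exact norm_Qop_T7_le ha₁ hC₃ (C1_nonneg hc₀.le hC₂ hR₀) hε₁ hFa h139 (analyticOnNhd_psi1 hDt hHop hC hc₀ hR)
    (norm_psi1_le hC hc₀ hC₂ hhD hR) h3 hrad hg hB

/-! ## §4. (1.20) from [I] p. 267 as typed in `B12Lineariz267` (`C₂ ↦ C₂b`) -/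

section lineariz

variable [CompleteSpace 𝒳] {Ct : 𝒴 → 𝒳} {R b ε : ℝ}

/-- The (1.14)-type bound for the composite `hD̃` from [I] p. 267's data: `QuadAnalytic C̃ C₂ R`, `‖hX‖ ≤ b‖X‖`, the
contraction smallness `9C₂bε < 1`, `3ε ≤ R`, and `D̃` THE fixed point in the ball — `‖hD̃(X)‖ ≤ 4(C₂b)‖X‖²` on `‖X‖ < ε`
(`B12Lineariz267.norm_hop_Dt_le`; print (1.20) writes `4C₂`, i.e. absorbs `‖h‖ ≤ b` into the constant).
[cite: Balaban1988RG2Cluster, (1.14) p.5] -/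
theorem quadBound_hop_Dt (hCt : QuadAnalytic Ct C₂ R) (hC₂ : 0 ≤ C₂) (hb : 0 ≤ b)
    (hHop : ∀ X, ‖hop X‖ ≤ b * ‖X‖) (hq : 9 * C₂ * b * ε < 1) (hRC : 3 * ε ≤ R)
    (hDball : ∀ B : 𝒴, ‖B‖ < ε → Dt B ∈ closedBall (0 : 𝒳) (4 * C₂ * ε ^ 2))
    (hDfix : ∀ B : 𝒴, ‖B‖ < ε → Ct (B - hop (Dt B)) = Dt B) :
    ∀ X : 𝒴, ‖X‖ < ε → ‖hop (Dt X)‖ ≤ 4 * (C₂ * b) * ‖X‖ ^ 2 := by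
  intro X hX
  have h := (B12Lineariz267.norm_hop_Dt_le hCt hC₂ hb hHop hq hRC hDball hDfix hX).1
  linarith

/-- **(1.20) from [I] p. 267's typed data**: with `D̃` the fixed point of `B12Lineariz267` (domain `‖X‖ < ε`),
`‖Cw‖ ≤ c₀‖w‖` and `c₀ε₁ ≤ ε`: on `g_k|B| < ε₁`, `‖B′‖ ≤ c₀g_k|B| + 4(C₂b)(c₀g_k|B|)² ≤ C₁g_k|B| < C₁ε₁`,
`C₁ = C1 c₀ (C₂b) ε₁`. [cite: Balaban1988RG2Cluster, (1.20) p.6] -/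
theorem ineq120_of_lineariz (hCt : QuadAnalytic Ct C₂ R) (hC₂ : 0 ≤ C₂) (hb : 0 ≤ b)
    (hHop : ∀ X, ‖hop X‖ ≤ b * ‖X‖) (hq : 9 * C₂ * b * ε < 1) (hRC : 3 * ε ≤ R)
    (hDball : ∀ B : 𝒴, ‖B‖ < ε → Dt B ∈ closedBall (0 : 𝒳) (4 * C₂ * ε ^ 2))
    (hDfix : ∀ B : 𝒴, ‖B‖ < ε → Ct (B - hop (Dt B)) = Dt B)
    (hC : ∀ w, ‖C w‖ ≤ c₀ * ‖w‖) (hc₀ : 0 < c₀) {ε₁ : ℝ} (hR : c₀ * ε₁ ≤ ε) {g : ℂ} {B : 𝒲}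
    (hB : ‖g‖ * ‖B‖ < ε₁) :
    ‖bPrime g C hop Dt B‖ ≤ c₀ * (‖g‖ * ‖B‖) + 4 * (C₂ * b) * (c₀ * (‖g‖ * ‖B‖)) ^ 2 ∧
      c₀ * (‖g‖ * ‖B‖) + 4 * (C₂ * b) * (c₀ * (‖g‖ * ‖B‖)) ^ 2 ≤ C1 c₀ (C₂ * b) ε₁ * (‖g‖ * ‖B‖) ∧
        C1 c₀ (C₂ * b) ε₁ * (‖g‖ * ‖B‖) < C1 c₀ (C₂ * b) ε₁ * ε₁ :=
  ineq120 hC hc₀ (mul_nonneg hC₂ hb) (quadBound_hop_Dt hCt hC₂ hb hHop hq hRC hDball hDfix) hR hB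

/-- The print's `4C₂` (no `‖h‖`): for `b ≤ 1` the first inequality of (1.20) holds VERBATIM for the typed `B′` built on
[I] p. 267's fixed point, `‖B′‖ ≤ c₀g_k|B| + 4C₂(c₀g_k|B|)²`. [cite: Balaban1988RG2Cluster, (1.20) p.6] -/
theorem ineq120_printed_of_b_le_one (hCt : QuadAnalytic Ct C₂ R) (hC₂ : 0 ≤ C₂) (hb : 0 ≤ b) (hb1 : b ≤ 1)
    (hHop : ∀ X, ‖hop X‖ ≤ b * ‖X‖) (hq : 9 * C₂ * b * ε < 1) (hRC : 3 * ε ≤ R)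
    (hDball : ∀ B : 𝒴, ‖B‖ < ε → Dt B ∈ closedBall (0 : 𝒳) (4 * C₂ * ε ^ 2))
    (hDfix : ∀ B : 𝒴, ‖B‖ < ε → Ct (B - hop (Dt B)) = Dt B)
    (hC : ∀ w, ‖C w‖ ≤ c₀ * ‖w‖) (hc₀ : 0 < c₀) {ε₁ : ℝ} (hR : c₀ * ε₁ ≤ ε) {g : ℂ} {B : 𝒲}
    (hB : ‖g‖ * ‖B‖ < ε₁) :
    ‖bPrime g C hop Dt B‖ ≤ c₀ * (‖g‖ * ‖B‖) + 4 * C₂ * (c₀ * (‖g‖ * ‖B‖)) ^ 2 := by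
  have h := (ineq120_of_lineariz hCt hC₂ hb hHop hq hRC hDball hDfix hC hc₀ hR hB).1
  have hsq : 0 ≤ (c₀ * (‖g‖ * ‖B‖)) ^ 2 := sq_nonneg _
  have h4 : 4 * (C₂ * b) * (c₀ * (‖g‖ * ‖B‖)) ^ 2 ≤ 4 * C₂ * (c₀ * (‖g‖ * ‖B‖)) ^ 2 := by
    have : 4 * (C₂ * b) ≤ 4 * C₂ := by nlinarith
    exact mul_le_mul_of_nonneg_right this hsq
  linarith

end lineariz

/-! ## §5. (v1.1) Every hypothesis from [I] p. 267's typed data: joint analyticity of `D̃` by name, T7 for the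
printed `B′`, and the constraint identically satisfied -/

section lineariz2

variable [CompleteSpace 𝒳] [CompleteSpace 𝒴] {Ct : 𝒴 → 𝒳} {R b ε : ℝ}

/-- **`Ψ₁` is analytic, from [I] p. 267's data alone**: `D̃` = the fixed point of `B12Lineariz267` is JOINTLY analytic on
`‖X‖ < ε` (`B12LinearizAnalytic267.analyticOnNhd_Dt`, from `QuadAnalytic C̃ C₂ R` + `C̃` analytic on `‖Y‖ < R` + the
contraction data), hence so is `Ψ₁ = (X ↦ X − hD̃(X)) ∘ C` on `‖w‖ < R₀`, `c₀R₀ ≤ ε` — the hypothesis `hΨa` of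
`B13PkScaling.norm_Qop_T7_le` with NO analyticity hypothesis on `D̃` left displayed. [cite: Balaban1988RG2Cluster, (1.19) p.6] -/
theorem analyticOnNhd_psi1_of_lineariz (hCt : QuadAnalytic Ct C₂ R) (hCa : AnalyticOnNhd ℂ Ct {Y : 𝒴 | ‖Y‖ < R})
    (hC₂ : 0 ≤ C₂) (hb : 0 ≤ b) (hHop : ∀ X, ‖hop X‖ ≤ b * ‖X‖) (hq : 9 * C₂ * b * ε < 1) (hRC : 3 * ε ≤ R)
    (hDball : ∀ B : 𝒴, ‖B‖ < ε → Dt B ∈ closedBall (0 : 𝒳) (4 * C₂ * ε ^ 2))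
    (hDfix : ∀ B : 𝒴, ‖B‖ < ε → Ct (B - hop (Dt B)) = Dt B)
    (hC : ∀ w, ‖C w‖ ≤ c₀ * ‖w‖) (hc₀ : 0 < c₀) {R₀ : ℝ} (hR : c₀ * R₀ ≤ ε) :
    AnalyticOnNhd ℂ (psi1 C hop Dt) (ball (0 : 𝒲) R₀) :=
  analyticOnNhd_psi1 (B12LinearizAnalytic267.analyticOnNhd_Dt hCt hCa hC₂ hb hHop hq hRC hDball hDfix) hHop hC hc₀ hR

/-- **Lemma 2 / T7 for THE PRINTED `B′`, every hypothesis from the typed data of [I] p. 267 and the bound on `C`**: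
`B13PkScaling.norm_Qop_T7_le` with `Ψ₁` = (1.19), `hΨa` by `analyticOnNhd_psi1_of_lineariz`, `h120` by `norm_psi1_le` with
the (1.14)-type constant `4C₂b` (`quadBound_hop_Dt`), `C₁ = C1 c₀ (C₂b) R₀`: on `g_k|B| ≤ ε₁` the operator of the quadratic
form of `g_k⁻²Fk(B′)` has norm `≤ ½·27·C₃e^{48κ₁}·M⁴e^{−(κ₁−1)|Y∖□|}·C₁³·ε₁` (p. 10 l. −1: *«Taking B′ as in (1.19) we obtain
the above bound with |B′| replaced by C₁ε₁»*). [cite: Balaban1988RG2Cluster, (1.37)–(1.43) pp.10–11] -/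
theorem norm_Qop_T7_bPrime_le_of_lineariz {G : Type*} [NormedAddCommGroup G] [NormedSpace ℂ G]
    {κ₁ a₁ C₃ M nYc ε₁ R₀ : ℝ} (ha₁ : 0 < a₁) (hC₃ : 0 ≤ C₃) (hε₁ : 0 < ε₁)
    {Fk : 𝒴 → G} (hFa : AnalyticOnNhd ℂ Fk (ball 0 (rad κ₁ a₁))) (h139 : Ineq139 Fk κ₁ a₁ C₃ M nYc)
    (hCt : QuadAnalytic Ct C₂ R) (hCa : AnalyticOnNhd ℂ Ct {Y : 𝒴 | ‖Y‖ < R}) (hC₂ : 0 ≤ C₂) (hb : 0 ≤ b)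
    (hHop : ∀ X, ‖hop X‖ ≤ b * ‖X‖) (hq : 9 * C₂ * b * ε < 1) (hRC : 3 * ε ≤ R)
    (hDball : ∀ B : 𝒴, ‖B‖ < ε → Dt B ∈ closedBall (0 : 𝒳) (4 * C₂ * ε ^ 2))
    (hDfix : ∀ B : 𝒴, ‖B‖ < ε → Ct (B - hop (Dt B)) = Dt B)
    (hC : ∀ w, ‖C w‖ ≤ c₀ * ‖w‖) (hc₀ : 0 < c₀) (hR : c₀ * R₀ ≤ ε) (h3 : 3 * ε₁ ≤ R₀)
    (hrad : C1 c₀ (C₂ * b) R₀ * R₀ ≤ rad κ₁ a₁) {g : ℂ} (hg : g ≠ 0) {B : 𝒲} (hB : ‖g‖ * ‖B‖ ≤ ε₁) :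
    ‖Qop (scaled g (Fk ∘ psi1 C hop Dt)) B‖ ≤
      1 / 2 * (27 * (C₃ * Real.exp (48 * κ₁) * (M ^ 4 * Real.exp (-(κ₁ - 1) * nYc)) * C1 c₀ (C₂ * b) R₀ ^ 3) * ε₁) := by
  have hR₀ : 0 ≤ R₀ := by linarith
  exact norm_Qop_T7_le ha₁ hC₃ (C1_nonneg hc₀.le (mul_nonneg hC₂ hb) hR₀) hε₁ hFa h139
    (analyticOnNhd_psi1_of_lineariz hCt hCa hC₂ hb hHop hq hRC hDball hDfix hC hc₀ hR)
    (norm_psi1_le hC hc₀ (mul_nonneg hC₂ hb) (quadBound_hop_Dt hCt hC₂ hb hHop hq hRC hDball hDfix) hR) h3 hrad hg hB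

omit [CompleteSpace 𝒳] [CompleteSpace 𝒴] in
/-- **The constraint is identically satisfied in the new variables** ([I] pp. 267–268: the substitution linearizes `Q̃`,
`B12Lineariz267.linearizes_Dt`, and `C` parametrizes the «remaining variables», `LQ̃ ∘ C = 0`): the constraint function of
the δ-function `δ(Q̃(B′))` vanishes at `B′ = g_kCB − hD̃(g_kCB)`, `LQ̃B′ + C̃(B′) = LQ̃(g_kCB) = 0`, whenever `‖g_kCB‖ < ε`.
Observation of the yielded parallel draft of seat p07 (`lit-balaban-p07/B13Eq119ChangeOfVariables.lean`,
`constraint_Bprime`), re-proved from `linearizes_Dt`. [cite: Balaban1988RG2Cluster, (1.19) p.6] -/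
theorem constraint_bPrime {LQ : 𝒴 →ₗ[ℂ] 𝒳} (hLQh : ∀ X, LQ (hop X) = X) (hLQC : ∀ w, LQ (C w) = 0)
    (hDfix : ∀ Y : 𝒴, ‖Y‖ < ε → Ct (Y - hop (Dt Y)) = Dt Y) {g : ℂ} {B : 𝒲} (hB : ‖g • C B‖ < ε) :
    LQ (bPrime g C hop Dt B) + Ct (bPrime g C hop Dt B) = 0 := by
  rw [bPrime_def, B12Lineariz267.linearizes_Dt hLQh hDfix hB, map_smul, hLQC, smul_zero]

end lineariz2

end Literature.MathematicalPhysics.QuantumFieldTheory.Balaban1983to89.B13Eq119BPrime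

end
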